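import Mathlib
import Summits.NavierStokesRegularity.FluidComputer.AbcInertiaCIEigenvalues
import Summits.NavierStokesRegularity.FluidComputer.AbcInertiaDictionary

/-!
# INERTIA-3L instantiation — CLASS I twin (instab3 g8; cert-3 g9's `AbcClassI` layer; character-free lemmas
# reused from the class-II files `AbcInertia*`). Part 12: the class-II DICTIONARY completed — coordinates ⇒ a classical
# eigenpair WITH class-II Fourier coefficients (instab3 g8, cell `ns-blowup`, 2026-08-27)

HONEST FRAMING (human ruling D-0035): nothing here is a claim about Navier–Stokes blow-up.
WHAT THIS IS NOT: not NS evidence. MODEL lane (forced-ABC linearisation, class II, coordinates of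
`AbcClassIIDefs`); no certificate, number or census word moves.

cert-3's `AbcClassIIEigenpair.coords_of_classII_certifier_eigen` + `AbcLatticeEigenAnalysis` turn a classical
eigenpair with class-II Fourier coefficients into a rapidly decaying coordinate eigenvector; instab4's
`AbcClassIISynthesis` + `AbcLatticeEigenSynthesis` turn coordinates into `Torus.IsLinNSEigenvalue` — but the
latter forgets the eigenfunction and its class. This file closes the loop:
* `isClassI_of_orbitwise` — the orbitwise synthesis `c(k) = Σ_a x⟨O,a⟩ AbcClassI.bfam⟨O,a⟩(k)` (`c 0 = 0`) of ANY
  coordinate vector is class II (orbits are closed under the frequency maps of the generators `r`, `s`);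
* `AbcInertia.linNSResolventRel_abcFlow_of_certifier_eigen` — the certifiers' eigen-equation for a rapidly decaying
  transversal `c` (`c 0 = 0`) ⇒ a classical solution `w` of `L w = 2πλ w` with `𝓕 w = c` (the `w`-returning
  form of `AbcLatticeEigenSynthesis.isLinNSEigenvalue_abcFlow_of_certifier_eigen`);
* `classI_eigenfunction_of_coordinates` — a rapidly decaying coordinate eigenvector `x ≠ 0`, `L x = λ x`
  ⇒ a classical eigenpair `(λ, u)`, `u ≠ 0`, WITH `IsClassI (𝓕 u)`;
* `eq_of_coordinate_leader` — with the INERTIA-3L count `≤ 1` of a cell `(R, a, 1)`: a coordinate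
  eigenvector with eigenvalue `λ₀`, `Re λ₀ ≥ a` (e.g. the one the X0 chain constructs) forces every classical
  class-II eigenvalue `z` with `Re z ≥ a` to equal `λ₀` — the «EXACTLY ONE» template; the remaining input is
  an EXPORTED coordinate eigenvector from the X0 rows (instab4/cert-3 files).

Mathlib + `AbcInertiaEigenvalues`; no new definitions; std axioms. [folklore]
-/

noncomputable section

open scoped BigOperators ComplexConjugate
open Finset MeasureTheory UnitAddTorus

namespace Summit.NavierStokesRegularity.FluidComputer.AbcInertiaCI

open Literature.Analysis.FunctionSpaces Literature.Analysis.FunctionSpaces.Torus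
open Literature.Analysis.FunctionSpaces.EuclideanSpace
open Literature.Analysis.FluidPDE Literature.Analysis.FluidPDE.SteadyLattice
open Literature.Analysis.FluidPDE.ScalarFourier
open Summit.NavierStokesRegularity.FluidComputer.AbcClassI
open Summit.NavierStokesRegularity.FluidComputer.AbcClassII (Fam crossForm secOp rotR rotS sgnAct sgnOrbit
  cube extend restrictTo extend_add extend_smul extend_zero rotR_add rotR_smul rotS_add rotS_smul
  crossForm_add crossForm_smul secOp_add secOp_smul restrictTo_add restrictTo_smul Orbit toOrbit onormSq
  osupNorm cubeOrbits nbrOrbits mem_sgnOrbit mem_sgnOrbit_self card_sgnOrbit_le sgnOrbit_eq_of_mem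
  mem_sgnOrbit_comm sgnOrbit_eq_or_disjoint neg_mem_sgnOrbit neg_self_mem_sgnOrbit rotFreqR_mem_sgnOrbit
  rotFreqS_mem_sgnOrbit freqNormSq_eq_of_mem_sgnOrbit supNorm_eq_of_mem_sgnOrbit mem_cube
  mem_cube_iff_supNorm cube_mono sgnOrbit_subset_cube zero_not_mem_sgnOrbit ne_zero_of_mem_sgnOrbit
  toOrbit_val toOrbit_eq_iff mem_cubeOrbits mem_nbrOrbits mem_nbrOrbits_comm card_nbrOrbits_le rotR_apply
  rotS_apply freqNormSq_rotFreq secOp_conj isConjSymm_secOp kdot_secOp mem_iff_of_orbitClosed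
  isConjSymm_cut kdot_cut orbitClosed_cube_ne_zero orbitClosed_shell neg_mem_of_orbitClosed
  isConjSymm_lerayCrossForm kdot_conj conj_eq_zero_of_not_mem linOp_zero_eq conj_theta_neg
  extend_apply_of_mem extend_apply_of_not_mem restrictTo_extend extend_restrictTo extend_sum
  inner_eq_sum_extend inner_conjVec_conjVec conj_sum_inner_of_isConjSymm sum_inner_eq_re_of_isConjSymm
  real_inner_eq_re real_smul_eq norm_lerayCrossForm_le sobolevWeight_one_eq cube_filter_eq_biUnion sum_cube_filter_eq
  onormSq_nonneg)

/-! ### §1 The orbitwise synthesis is class II -/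

/-- **The orbitwise synthesis of a coordinate vector is class II.** -/
theorem isClassI_of_orbitwise {x : AbcClassI.Idx → ℂ} {c : Fam} (hc0 : c 0 = 0)
    (hc : ∀ (O : Orbit) (k : Fin 3 → ℤ), k ∈ O.1 → c k = ∑ a : Fin (AbcClassI.odim O), x ⟨O, a⟩ • AbcClassI.bfam ⟨O, a⟩ k) :
    IsClassI c := by
  classical
  -- on the orbit of a non-zero `m`, `c` is the finite class-II combination `F_O`
  have hF : ∀ (O : Orbit), IsClassI (∑ a : Fin (AbcClassI.odim O), x ⟨O, a⟩ • AbcClassI.bfam ⟨O, a⟩) := fun O =>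
    isClassI_sum_smul_bfam Finset.univ (fun a => (⟨O, a⟩ : AbcClassI.Idx)) fun a => x ⟨O, a⟩
  have hcF : ∀ (O : Orbit) (k : Fin 3 → ℤ), k ∈ O.1 →
      c k = (∑ a : Fin (AbcClassI.odim O), x ⟨O, a⟩ • AbcClassI.bfam ⟨O, a⟩) k := by
    intro O k hk; rw [hc O k hk, Finset.sum_apply]; rfl
  refine ⟨?_, ?_⟩
  · funext m; ext p
    rw [rotR_apply]
    by_cases hm : m = 0
    · subst hm
      have h0 : (fun i : Fin 3 => (0 : Fin 3 → ℤ) ((finRotate 3).symm i)) = 0 := by funext i; rfl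
      rw [h0, hc0]
      simp
    · set O : Orbit := toOrbit m hm with hO
      have hmO : m ∈ O.1 := mem_sgnOrbit_self m
      have hm'O := O.rotFreqR_mem hmO
      have h := congrArg (fun g : Fam => g m p) (hF O).1
      simp only [rotR_apply] at h
      rw [hcF O _ hm'O, hcF O m hmO]
      exact h
  · funext m; ext p
    rw [rotS_apply]
    by_cases hm : m = 0
    · subst hm
      have h0 : (fun i : Fin 3 => (![1, 1, -1] : Fin 3 → ℤ) ((Equiv.swap (1 : Fin 3) 2).symm i) *
          (0 : Fin 3 → ℤ) ((Equiv.swap (1 : Fin 3) 2).symm i)) = 0 := by funext i; simp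
      rw [h0, hc0]
      simp
    · set O : Orbit := toOrbit m hm with hO
      have hmO : m ∈ O.1 := mem_sgnOrbit_self m
      have hm'O := O.rotFreqS_mem hmO
      have h := congrArg (fun g : Fam => g m p) (hF O).2
      simp only [rotS_apply] at h
      rw [hcF O _ hm'O, hcF O m hmO]
      exact h

/-! ### §2 The eigenfunction-returning synthesis at the ABC background -/

/-! ### §3 Coordinates ⇒ a classical eigenpair with class-II Fourier coefficients -/

/-- **A rapidly decaying class-II coordinate eigenvector is a classical eigenpair with class-II Fourier
coefficients.** -/
theorem classI_eigenfunction_of_coordinates {R : ℝ} (hR : 0 < R) (lam : ℂ) (x : AbcClassI.Idx → ℂ)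
    (hxr : ∀ s : ℕ, Summable fun i : AbcClassI.Idx => (1 + onormSq i.1) ^ s * ‖x i‖ ^ 2) (hx0 : x ≠ 0)
    (heig : ∀ i : AbcClassI.Idx, ((-(onormSq i.1 / R) : ℝ) : ℂ) * x i + ∑ j ∈ AbcClassI.nbrIdx i, ((AbcClassI.amat i j : ℝ) : ℂ) * x j =
      lam * x i) :
    ∃ u : UnitAddTorus (Fin 3) → EuclideanSpace ℂ (Fin 3),
      Torus.LinNSResolventRel (1 / (2 * Real.pi * R)) (Torus.abcFlow 1 1 1) (2 * Real.pi * lam) u 0 ∧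
        u ≠ 0 ∧ IsClassI (mFourierCoeff u) := by
  classical
  obtain ⟨c, hc0, hc⟩ := exists_orbitwise x
  have hcr : RapidDecay c := rapidDecay_of_coordinates c x hc hc0 hxr
  have hct := kdot_of_coordinates c x hc hc0
  have hcII : IsClassI c := isClassI_of_orbitwise hc0 hc
  have hL : ∀ k : Fin 3 → ℤ, ((-(freqNormSq k / R) : ℝ) : ℂ) • c k +
      Torus.lerayCoeff k (crossForm 1 1 1 c k) = lam • c k :=
    fun k => certifier_eigen_of_coordinates lam c x hc hc0 heig k
  obtain ⟨i, hi⟩ : ∃ i, x i ≠ 0 := by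
    by_contra h; push Not at h; exact hx0 (funext h)
  have hcne : c ≠ 0 := ne_zero_of_coordinates c x hc hi
  obtain ⟨w, hw, hŵ⟩ := AbcInertia.linNSResolventRel_abcFlow_of_certifier_eigen 1 1 1 hR lam hcr hct hc0 hL
  refine ⟨w, hw, fun h0 => hcne ?_, by rw [hŵ]; exact hcII⟩
  rw [← hŵ, h0]
  funext k
  simp [mFourierCoeff]

/-- **The «EXACTLY ONE» template.** Given the INERTIA-3L count `≤ 1` for the cell `(R, a, 1)` and ONE
rapidly decaying coordinate eigenvector `x₀ ≠ 0` with eigenvalue `λ₀`, `Re λ₀ ≥ a`: every classical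
eigenpair `(z, u)` with class-II Fourier coefficients and `Re z ≥ a` has `z = λ₀`. -/
theorem eq_of_coordinate_leader {R a : ℝ} (hR : 0 < R)
    (hcount1 : ∀ (W : Submodule ℂ (AbcClassI.Idx → ℂ)), FiniteDimensional ℂ W →
      (∀ x ∈ W, ∀ s : ℕ, Summable fun i : AbcClassI.Idx => (1 + onormSq i.1) ^ s * ‖x i‖ ^ 2) →
      (∀ x ∈ W, (fun i : AbcClassI.Idx => ((-(onormSq i.1 / R) : ℝ) : ℂ) * x i +
        ∑ j ∈ AbcClassI.nbrIdx i, ((AbcClassI.amat i j : ℝ) : ℂ) * x j) ∈ W) →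
      (∀ (μ : ℂ) (x : AbcClassI.Idx → ℂ), x ∈ W → x ≠ 0 →
        (∀ i : AbcClassI.Idx, ((-(onormSq i.1 / R) : ℝ) : ℂ) * x i + ∑ j ∈ AbcClassI.nbrIdx i, ((AbcClassI.amat i j : ℝ) : ℂ) * x j = μ * x i) →
        a ≤ μ.re) →
      Module.finrank ℂ W ≤ 1)
    (lam₀ : ℂ) (hlam₀ : a ≤ lam₀.re) (x₀ : AbcClassI.Idx → ℂ)
    (hx₀r : ∀ s : ℕ, Summable fun i : AbcClassI.Idx => (1 + onormSq i.1) ^ s * ‖x₀ i‖ ^ 2) (hx₀0 : x₀ ≠ 0)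
    (hx₀ : ∀ i : AbcClassI.Idx, ((-(onormSq i.1 / R) : ℝ) : ℂ) * x₀ i + ∑ j ∈ AbcClassI.nbrIdx i, ((AbcClassI.amat i j : ℝ) : ℂ) * x₀ j =
      lam₀ * x₀ i)
    (z : ℂ) (u : UnitAddTorus (Fin 3) → EuclideanSpace ℂ (Fin 3))
    (hu : Torus.LinNSResolventRel (1 / (2 * Real.pi * R)) (Torus.abcFlow 1 1 1) (2 * Real.pi * z) u 0)
    (hu0 : u ≠ 0) (huII : IsClassI (mFourierCoeff u)) (hzre : a ≤ z.re) : z = lam₀ := by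
  obtain ⟨u₀, hu₀, hu₀0, hu₀II⟩ := classI_eigenfunction_of_coordinates hR lam₀ x₀ hx₀r hx₀0 hx₀
  by_contra hne
  have hinj : Function.Injective ![lam₀, z] := by
    intro i j h
    fin_cases i <;> fin_cases j
    · rfl
    · exact absurd h.symm hne
    · exact absurd h hne
    · rfl
  have h := card_classI_eigenfunctions_le hR hcount1 ![lam₀, z] hinj ![u₀, u]
    (fun k => by fin_cases k <;> assumption) (fun k => by fin_cases k <;> assumption)
    (fun k => by fin_cases k <;> assumption) (fun k => by fin_cases k <;> assumption)
  omega

end Summit.NavierStokesRegularity.FluidComputer.AbcInertiaCI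

end
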